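import Mathlib
import Literature.NumberTheory.LFunctions.Zhang2022.Section14Prop141Discharge
import Literature.NumberTheory.LFunctions.Zhang2022.Section14Eq145Discharge
import Literature.NumberTheory.LFunctions.Zhang2022.SkeletonWindowPowers
import HarnessLib

/-!
# Zhang (2022) §14: Proposition 14.1 at GENERAL `β` — the two deduction edges with the twist
# `(p t₀)^β` carried, kernel-checked (leaf `Skeleton.Prop141`, cone C36, rows G-L3t7-1 / G-adj2-4)

Topic `Literature/NumberTheory/LFunctions/Zhang2022` (Landau–Siegel audit tree; verdict-neutral).
Y. Zhang, *Discrete mean estimates and the Landau–Siegel zero*, arXiv:2211.02515v1 (2022)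
[Zhang2022LandauSiegel] — **an unrefereed manuscript under adjudication**; this file PROVES
implications between explicitly stated estimates; it does not assert the estimates themselves and
says nothing about Theorems 1–2 of the manuscript or about Landau–Siegel zeros.

§14 p. 76 (tex L3849): "We prove this proposition with `β = 0` only, as the general case is almost
identical." The typed §14 chain (`TypedSection14`, `Section14Prop141Discharge.dedProp141_holds`,
`Section14Eq145Discharge.dedEq145_holds`) delivers the `β = 0` case `Prop141Zero`; the banked leaf
`Skeleton.Prop141` quantifies over all `|β| < 5α`. The one structural fact this file records and
exploits: `β` enters `Θ₂(β,𝐤*,𝐚*)` (`Skeleton.Theta2`) and the main term (`Skeleton.main141`) ONLY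
through the per-modulus weight `(p_ψ t₀)^β` — here the object `wt D β p` — so that every PER-`ψ` /
PER-`p` node of the `β = 0` chain (u004–u010, (14.7), u013, u015) is consumed UNCHANGED, and the
general case needs the twist only inside the two `p`-sums that are estimated with cancellation,
(14.5)/(14.8) and (14.6), and in (14.3). Accordingly this file proves, with the twisted estimates as
EXPLICIT HYPOTHESES (inline statements; no new `Prop` definition stands in for a step of the
manuscript):

* `eq145W_of_parts` — the general-`β` twin of `dedEq145_holds`: (14.7) ∧ u013 ∧ u015 ∧ (14.8)ᵂ ⇒
  (14.5)ᵂ, where (14.8)ᵂ is `lhs148W χ β 𝐤* 𝐚* ≪ P²D^{−c}` (the left side of (14.8) with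
  `χθ̄(p) ↦ χθ̄(p)(pt₀)^β`) and (14.5)ᵂ is (14.5) with `χ(p) ↦ χ(p)(pt₀)^β` on the left and
  `(pt₀)^β` inserted in the `p`-sum of the main term;
* `prop141_of_parts` — the general-`β` twin of `dedProp141_holds`: (14.3)ᵂ ∧ u010 ∧ (14.5)ᵂ ∧
  (14.6)ᵂ ⇒ `Skeleton.Prop141` (BY NAME), where (14.3)ᵂ is `Θ₂(β) = Σ_{ψ∈Ψ}(p_ψt₀)^β Ĩ₂(ψ) + o(𝔓)`
  and (14.6)ᵂ is `Σ_{p∼P} χ(p)(pt₀)^β 𝒮(D₁,D₂;p) ≪ P²D^{1/2−c}` (`D₁ > 1`);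

together with the objects `wt`, `lhs148W`, `rhs1417OnW` (the u017 majorant on an `r`-range with the
twist — the target shape of the two (14.8) legs at general `β`), their `β = 0` reductions to the typed
`lhs148` / `rhs1417On` (`lhs148W_zero`, `rhs1417OnW_zero`), and the size of the twist on the window,
`‖(pt₀)^β‖ ≤ e^{15π}` for `|β| ≤ 5α`, `p ∼ P`, `𝓛 ≥ 3` (`norm_wt_le`; `α log P = π`, `t₀ = 𝓛⁵¹⁹`).

## References

* Y. Zhang, arXiv:2211.02515v1 (2022), §14 pp. 76–79, Prop. 14.1, (14.3)–(14.8); §2 (2.8)–(2.10).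
  [cite: Zhang2022LandauSiegel, §14 Prop. 14.1 (proof) pp.76–79, tex L3836–L3969]
-/

noncomputable section

open Complex Real ComplexConjugate

namespace Literature.NumberTheory.LFunctions.Zhang2022.Typed.Sec14

open Skeleton Filter

/-! ### The twist `(p t₀)^β` and the twisted (14.8) objects -/

section Objects

/-- **The per-modulus weight `(p t₀)^β`** of `Θ₂(β,𝐤*,𝐚*)` and of the main term of Proposition 14.1
(§14 p. 76, tex L3834/L3842: `Σ_{ψ∈Ψ₁}(p_ψt₀)^β …`, `Σ_{p∼P}(pt₀)^β …`), as a function of the prime `p`.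
[cite: Zhang2022LandauSiegel, §14 Prop. 14.1 p.76, tex L3834] -/
def wt (D : ℕ) (β : ℂ) (p : ℕ) : ℂ := (((p : ℝ) * t0 D : ℝ) : ℂ) ^ β

/-- At `β = 0` the weight is `1`. [cite: Zhang2022LandauSiegel, §14 p.76] -/
@[simp] theorem wt_zero (D p : ℕ) : wt D 0 p = 1 := by simp [wt]

variable {D : ℕ} (χ : DirichletCharacter ℂ D)

/-- **The left side of (14.8) with the twist** (§14 p. 79, tex L3945, "the general case is almost
identical", p. 76): `Σ_d d⁻¹ Σ_k |a*(dk)|/(φ(Dk)k) Σ'_{θ≠ψ⁰,θ_k¹} |τ(θ̄)| |Σ_l κ*(dl)θ(l) Σ_{p∼P} χθ̄(p)(pt₀)^β Δ(l/(Dpk))|`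
— the typed `lhs148` with `χθ̄(p) ↦ χθ̄(p)(pt₀)^β`. [cite: Zhang2022LandauSiegel, §14 (14.8) p.79, tex L3945] -/
def lhs148W (β : ℂ) (κs as : ℕ → ℂ) : ℝ :=
  ∑ d ∈ Finset.Icc 1 ⌊2 * P4 D⌋₊, (d : ℝ)⁻¹ * ∑ k ∈ Finset.Icc 1 ⌊2 * P4 D⌋₊,
    ‖as (d * k)‖ / ((Nat.totient (D * k) : ℝ) * k) *
      ∑ θ ∈ finsetOf {θ : DirichletCharacter ℂ (D * k) | θ ≠ 1 ∧ θ ≠ thetaOne χ k},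
        ‖tauSum (D * k) θ⁻¹‖ *
          ‖∑' l : ℕ, κs (d * l) * θ (l : ZMod (D * k)) *
              ∑ p ∈ primeWindow D, χ (p : ZMod D) * θ⁻¹ (p : ZMod (D * k)) * wt D β p *
                DeltaW D ((l : ℝ) / ((D : ℝ) * p * k))‖

/-- **The u017 majorant on an `r`-range `S`, with the twist** (§14 p. 79, tex L3956): the typed
`rhs1417On` with `χθ̄(p) ↦ χθ̄(p)(pt₀)^β` — the common target shape of the two `r`-ranges of (14.8)
("`1 < r < D³`: Mellin transform, Lemma 5.4 (i), Lemma 5.6; `D³ ≤ r < 2DP₄`: … the large sieve") at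
general `β`. [cite: Zhang2022LandauSiegel, §14 u017 p.79, tex L3956–L3963] -/
def rhs1417OnW (β : ℂ) (κs : ℕ → ℂ) (S : Finset ℕ) : ℝ :=
  ∑ d ∈ Finset.Icc 1 ⌊2 * P4 D⌋₊, (d : ℝ)⁻¹ * ∑ r ∈ S,
    ∑ h ∈ (Finset.Ico 1 ⌈bigP D / r⌉₊).filter (fun h => D / Nat.gcd D r ∣ h),
      (D : ℝ) / ((Nat.totient (h * r) : ℝ) * h * Real.sqrt r) *
        ∑ θ ∈ finsetOf {θ : DirichletCharacter ℂ r | θ.IsPrimitive ∧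
            DirichletCharacter.changeLevel (dvd_mul_left r D) θ ≠
              DirichletCharacter.changeLevel (dvd_mul_right D r) χ},
          ‖∑' l : ℕ, if Nat.Coprime l h then
              κs (d * l) * θ (l : ZMod r) *
                ∑ p ∈ primeWindow D, χ (p : ZMod D) * θ⁻¹ (p : ZMod r) * wt D β p *
                  DeltaW D ((l : ℝ) / ((p : ℝ) * h * r)) else 0‖

/-- At `β = 0` the twisted left side of (14.8) is the typed one. [cite: Zhang2022LandauSiegel, §14 (14.8) p.79] -/
theorem lhs148W_zero (κs as : ℕ → ℂ) : lhs148W χ 0 κs as = lhs148 χ κs as := by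
  simp only [lhs148W, lhs148, wt_zero, mul_one]

/-- At `β = 0` the twisted u017 majorant is the typed one. [cite: Zhang2022LandauSiegel, §14 u017 p.79] -/
theorem rhs1417OnW_zero (κs : ℕ → ℂ) (S : Finset ℕ) : rhs1417OnW χ 0 κs S = rhs1417On χ κs S := by
  simp only [rhs1417OnW, rhs1417On, wt_zero, mul_one]

/-- Every term of the twisted u017 majorant is non-negative. [cite: Zhang2022LandauSiegel, §14 u017 p.79] -/
theorem rhs1417OnW_nonneg (β : ℂ) (κs : ℕ → ℂ) (S : Finset ℕ) : 0 ≤ rhs1417OnW χ β κs S := by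
  unfold rhs1417OnW
  refine Finset.sum_nonneg fun d _ => mul_nonneg (inv_nonneg.mpr (Nat.cast_nonneg d)) ?_
  refine Finset.sum_nonneg fun r _ => Finset.sum_nonneg fun h _ => mul_nonneg ?_ ?_
  · exact div_nonneg (Nat.cast_nonneg D)
      (mul_nonneg (mul_nonneg (Nat.cast_nonneg _) (Nat.cast_nonneg h)) (Real.sqrt_nonneg r))
  · exact Finset.sum_nonneg fun θ _ => norm_nonneg _

omit χ in
/-- **The twist is bounded on the window**: for `𝓛 ≥ 3`, `p ∼ P` and `|β| ≤ 5α`,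
`‖(pt₀)^β‖ ≤ e^{15π}` (`‖x^β‖ = x^{Re β}`, `1 ≤ pt₀`, `log(pt₀) ≤ 3𝓛⁹ = 3 log P`, `α log P = π`).
[cite: Zhang2022LandauSiegel, §2 (2.8), (2.10); §14 p.76] -/
theorem norm_wt_le {D p : ℕ} (hℓ : 3 ≤ ell D) (hp : p ∈ primeWindow D) {β : ℂ}
    (hβ : ‖β‖ ≤ 5 * alpha D) : ‖wt D β p‖ ≤ Real.exp (15 * π) := by
  have hℓ0 : 0 < ell D := by linarith
  have hℓ1 : 1 ≤ ell D := by linarith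
  have hP := bigP_pos D
  have hp0 : (0 : ℝ) < p := pos_of_mem_primeWindow hp
  have ht0 : 1 ≤ t0 D := by rw [t0]; exact one_le_pow₀ hℓ1
  set x : ℝ := (p : ℝ) * t0 D with hx
  have hx0 : 0 < x := by positivity
  -- `1 ≤ x`
  have hP1 : 1 ≤ bigP D := by rw [bigP]; exact Real.one_le_exp (by positivity)
  have hp1 : 1 ≤ (p : ℝ) := hP1.trans (bigP_lt_of_mem_primeWindow hp).le
  have hx1 : 1 ≤ x := by rw [hx]; nlinarith
  -- `‖x^β‖ = x^{Re β} ≤ x^{5α}`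
  have hnorm : ‖wt D β p‖ = x ^ β.re := by
    rw [wt, ← hx, Complex.norm_cpow_eq_rpow_re_of_pos hx0]
  have hre : β.re ≤ 5 * alpha D := (Complex.re_le_norm β).trans hβ
  rw [hnorm]
  refine (Real.rpow_le_rpow_of_exponent_le hx1 hre).trans ?_
  -- `x^{5α} = exp(5α log x)` and `log x ≤ 3𝓛⁹`
  have hlogp : Real.log p ≤ ell D ^ 9 + 1 := by
    have h1 := log_le_log_bigP_add_of_mem_primeWindow hℓ1 hp
    have h2 : (ell D ^ 68)⁻¹ ≤ 1 := inv_le_one_of_one_le₀ (one_le_pow₀ hℓ1)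
    have h3 : Real.log (bigP D) = ell D ^ 9 := by rw [bigP, Real.log_exp]
    rw [h3] at h1
    linarith
  have hlogt : Real.log (t0 D) ≤ ell D ^ 9 := by
    rw [t0, Real.log_pow]
    have h1 : Real.log (ell D) ≤ ell D := (Real.log_le_sub_one_of_pos hℓ0).trans (by linarith)
    have h8 : (519 : ℝ) ≤ ell D ^ 8 :=
      calc (519 : ℝ) ≤ 3 ^ 8 := by norm_num
        _ ≤ ell D ^ 8 := pow_le_pow_left₀ (by norm_num) hℓ 8
    calc (519 : ℕ) * Real.log (ell D) ≤ 519 * ell D := by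
          push_cast; exact mul_le_mul_of_nonneg_left h1 (by norm_num)
      _ ≤ ell D ^ 8 * ell D := mul_le_mul_of_nonneg_right h8 hℓ0.le
      _ = ell D ^ 9 := by ring
  have h9 : 1 ≤ ell D ^ 9 := one_le_pow₀ hℓ1
  have hlogx : Real.log x ≤ 3 * ell D ^ 9 := by
    rw [hx, Real.log_mul hp0.ne' (by positivity)]
    linarith
  have hα : 0 < alpha D := alpha_pos' hℓ0
  have hαlog : 5 * alpha D * Real.log x ≤ 15 * π := by
    have h1 : alpha D * ell D ^ 9 = π := by
      have := alpha_mul_log_bigP (D := D) hℓ0.ne'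
      rwa [show Real.log (bigP D) = ell D ^ 9 by rw [bigP, Real.log_exp]] at this
    calc 5 * alpha D * Real.log x ≤ 5 * alpha D * (3 * ell D ^ 9) :=
          mul_le_mul_of_nonneg_left hlogx (by positivity)
      _ = 15 * (alpha D * ell D ^ 9) := by ring
      _ = 15 * π := by rw [h1]
  rw [Real.rpow_def_of_pos hx0]
  exact Real.exp_le_exp.mpr (by rw [mul_comm]; exact hαlog)

end Objects

/-! ### Eventual smallness of `(log D)^k D^{-c}` (a copy of the private helper of `Section14Prop141Discharge`) -/

/-- `(log D)^k · D^{−c} → 0`. [folklore] -/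
private theorem tendsto_log_pow_mul_rpow_neg' (k : ℕ) {c : ℝ} (hc : 0 < c) :
    Tendsto (fun D : ℕ => Real.log D ^ k * (D : ℝ) ^ (-c)) atTop (nhds 0) := by
  have h1 : Tendsto (fun y : ℝ => y ^ (k : ℝ) * Real.exp (-c * y)) atTop (nhds 0) :=
    tendsto_rpow_mul_exp_neg_mul_atTop_nhds_zero k c hc
  have h2 : Tendsto (fun D : ℕ => Real.log (D : ℝ)) atTop atTop :=
    Real.tendsto_log_atTop.comp tendsto_natCast_atTop_atTop
  refine ((h1.comp h2).congr' ?_)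
  filter_upwards [eventually_gt_atTop 0] with D hD
  have hD' : (0 : ℝ) < D := by exact_mod_cast hD
  simp only [Function.comp_apply]
  rw [Real.rpow_natCast, Real.rpow_def_of_pos hD']
  congr 1
  ring_nf

/-! ### Regrouping the weighted sum over `Ψ` by modulus -/

section Regroup

variable {D : ℕ} [NeZero D] (χ : DirichletCharacter ℂ D)

/-- `Σ_{ψ∈Ψ} (p_ψt₀)^β Ĩ₂(ψ) = Σ_{p∼P} (pt₀)^β Σ*_{ψ (mod p)} Ĩ₂(ψ)`: the weight depends on the modulus
only. [cite: Zhang2022LandauSiegel, §14 (14.3)–(14.4) pp.76–77] -/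
theorem sum_finsetOf_univ_wt_eq (β : ℂ) (κs as : ℕ → ℂ) :
    ∑ x ∈ finsetOf (Set.univ : Set (Chr D)), wt D β x.p * i2Tilde χ x κs as =
      ∑ p ∈ primeWindow D, wt D β p * i2Star χ p κs as := by
  rw [sum_finsetOf_univ_eq_sum_primeWindow]
  refine Finset.sum_congr rfl fun p _ => ?_
  rw [i2Star, Finset.mul_sum]
  refine Finset.sum_congr rfl fun x hx => ?_
  have hx' : x ∈ ({x : Chr D | x.p = p} : Set (Chr D)) := (mem_finsetOf (Set.toFinite _)).mp hx
  rw [Set.mem_setOf_eq] at hx'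
  rw [hx']

end Regroup

/-! ### The deduction edge of Proposition 14.1 at general `β` -/

/-- **Proposition 14.1 at general `β` from the twisted inputs** — the general-`β` twin of
`dedProp141_holds` ("the general case is almost identical", §14 p. 76, tex L3849): (14.3)ᵂ ∧ u010 ∧
(14.5)ᵂ ∧ (14.6)ᵂ ⇒ `Skeleton.Prop141`. Here (14.3)ᵂ, (14.5)ᵂ, (14.6)ᵂ are the displays (14.3), (14.5),
(14.6) with the weight `(pt₀)^β` (`wt D β p`) carried inside the `p`-sums, stated inline as hypotheses;
u010 (`Step14u010`, per `p`) is consumed unchanged. Bookkeeping as in `dedProp141_holds`: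
`Θ₂(β) = Σ_{p∼P}(pt₀)^β Σ*_ψ Ĩ₂(ψ) + o(𝔓)`; each `Σ*_ψ Ĩ₂(ψ)` is `τ(χ)χ(p)/D Σ_{D=D₁D₂}𝒮(D₁,D₂;p) +
O(PT^{−c})` and `|(pt₀)^β| ≤ e^{15π}` (`norm_wt_le`), so `Σ_p |(pt₀)^β| PT^{−c} ≤ e^{15π}T^{−c}𝔓`; the
`D₁ = 1` term gives the weighted main term by (14.5)ᵂ and `τ(χ)·χ(−1)τ(χ)/(Dφ(D)) = 1/φ(D)`; the `D₁ > 1`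
terms are `≪ P²D^{1/2−c}` each by (14.6)ᵂ, `d(D) ≪ D^{c/2}` of them; `P²D^{−c'} = o(𝔓)` by (2.9).
[cite: Zhang2022LandauSiegel, §14 Prop. 14.1 (proof) pp.76–78, tex L3836–L3917] -/
theorem prop141_of_parts
    (h143 : ∀ B : ℝ, ∀ ε : ℝ, 0 < ε → ForAllLarge fun D _ χ => AssumptionA D χ →
      ∀ β : ℂ, ‖β‖ < 5 * alpha D → ∀ κs as : ℕ → ℂ, Eq141 B κs → Eq142 D B as →
        ‖Theta2 χ β κs as -
            ∑ x ∈ finsetOf (Set.univ : Set (Chr D)), wt D β x.p * i2Tilde χ x κs as‖ ≤ ε * frakP D)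
    (h010 : Step14u010)
    (h145 : ∀ B : ℝ, ∃ c : ℝ, 0 < c ∧ ∃ C : ℝ, ForAllLarge fun D _ χ => AssumptionA D χ →
      ∀ β : ℂ, ‖β‖ < 5 * alpha D → ∀ κs as : ℕ → ℂ, Eq141 B κs → Eq142 D B as →
        ‖(∑ p ∈ primeWindow D, χ (p : ZMod D) * wt D β p * calS D 1 D p κs as) -
            χ (-1) * GammaFactor.tau χ / Nat.totient D *
              ∑ p ∈ primeWindow D, wt D β p * mainSum14 χ p κs as‖
          ≤ C * bigP D ^ 2 * (D : ℝ) ^ (1 / 2 - c))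
    (h146 : ∀ B : ℝ, ∃ c : ℝ, 0 < c ∧ ∃ C : ℝ, ForAllLarge fun D _ χ => AssumptionA D χ →
      ∀ β : ℂ, ‖β‖ < 5 * alpha D → ∀ κs as : ℕ → ℂ, Eq141 B κs → Eq142 D B as →
        ∀ D₁ D₂ : ℕ, D₁ * D₂ = D → 1 < D₁ →
          ‖∑ p ∈ primeWindow D, χ (p : ZMod D) * wt D β p * calS D D₁ D₂ p κs as‖
            ≤ C * bigP D ^ 2 * (D : ℝ) ^ (1 / 2 - c)) :
    Prop141 := by
  intro B ε hε
  obtain ⟨c₁, hc₁, C₁, h1⟩ := h010 B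
  obtain ⟨c₂, hc₂, C₂, h2⟩ := h145 B
  obtain ⟨c₃, hc₃, C₃, h3⟩ := h146 B
  have hε3 : 0 < ε / 3 := by positivity
  obtain ⟨D₀, hall⟩ := (((h143 B (ε / 3) hε3).and h1).and h2).and h3
  -- the divisor bound `d(D) ≤ Cτ D^{c₃/2}`
  obtain ⟨Cτ, hCτ1, hCτ⟩ :=
    Literature.NumberTheory.Sieve.exists_card_divisors_le_mul_rpow (half_pos hc₃)
  set c : ℝ := min c₂ (c₃ / 2) with hc_def
  have hc : 0 < c := lt_min hc₂ (half_pos hc₃)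
  set K : ℝ := |C₂| + |C₃| * Cτ with hK_def
  have hCτ0 : 0 ≤ Cτ := by linarith
  have hK : 0 ≤ K := by positivity
  -- the size of the twist
  set W : ℝ := Real.exp (15 * π) with hW_def
  have hW0 : 0 ≤ W := (Real.exp_pos _).le
  -- eventual smallness of the error scales
  obtain ⟨D₁, hD₁⟩ := eventually_bigP_sq_le_frakP
  obtain ⟨D₃, hD₃⟩ := exists_nat_forall_le_ell 3
  have evT : ∀ᶠ D : ℕ in atTop, W * |C₁| * bigT D ^ (-c₁) < ε / 3 := by
    have h := (tendsto_bigT_rpow_neg hc₁).const_mul (W * |C₁|)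
    rw [mul_zero] at h
    exact h.eventually_lt_const hε3
  have evD : ∀ᶠ D : ℕ in atTop, K * (2 * Real.log D ^ 77) * (D : ℝ) ^ (-c) < ε / 3 := by
    have h := ((tendsto_log_pow_mul_rpow_neg' 77 hc).const_mul (2 : ℝ)).const_mul K
    simp only [mul_zero] at h
    refine (h.eventually_lt_const hε3).mono fun D hD => ?_
    calc K * (2 * Real.log D ^ 77) * (D : ℝ) ^ (-c)
        = K * (2 * (Real.log D ^ 77 * (D : ℝ) ^ (-c))) := by ring
      _ < ε / 3 := hD
  obtain ⟨D₂, hD₂⟩ := Filter.eventually_atTop.mp (evT.and evD)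
  refine ⟨max (max (max D₀ D₁) D₂) D₃, fun D _ χ hD hq hp hA β hβ κs as hκ ha1 ha2 => ?_⟩
  have hD0 : D₀ ≤ D := le_trans (le_trans (le_trans (le_max_left _ _) (le_max_left _ _)) (le_max_left _ _)) hD
  have hD1 : D₁ ≤ D := le_trans (le_trans (le_trans (le_max_right _ _) (le_max_left _ _)) (le_max_left _ _)) hD
  have hD2 : D₂ ≤ D := le_trans (le_trans (le_max_right _ _) (le_max_left _ _)) hD
  have hℓ3 : 3 ≤ ell D := hD₃ D (le_trans (le_max_right _ _) hD)
  have ha : Eq142 D B as := ⟨ha1, ha2⟩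
  obtain ⟨⟨⟨e143, e010⟩, e145⟩, e146⟩ := hall D χ hD0 hq hp
  obtain ⟨hT, hDc⟩ := hD₂ D hD2
  have hPf := hD₁ D hD1
  have hDpos : (0 : ℝ) < D := by exact_mod_cast Nat.pos_of_ne_zero (NeZero.ne D)
  have hD1' : (1 : ℝ) ≤ D := by exact_mod_cast Nat.one_le_iff_ne_zero.mpr (NeZero.ne D)
  have hfP : 0 ≤ frakP D := frakP_nonneg D
  have hwt : ∀ p ∈ primeWindow D, ‖wt D β p‖ ≤ W := fun p hp' => norm_wt_le hℓ3 hp' hβ.le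
  -- abbreviations
  set τ : ℂ := GammaFactor.tau χ with hτdef
  set S : ℕ → ℂ := fun p => wt D β p * i2Star χ p κs as with hSdef
  set A : ℕ × ℕ → ℕ → ℂ := fun e p => calS D e.1 e.2 p κs as with hAdef
  set M : ℂ := ∑ p ∈ primeWindow D, wt D β p * mainSum14 χ p κs as with hMdef
  set Sx : ℕ × ℕ → ℂ := fun e => ∑ p ∈ primeWindow D, χ (p : ZMod D) * wt D β p * A e p with hSxdef
  set ER : Finset (ℕ × ℕ) := (Nat.divisorsAntidiagonal D).erase (1, D) with hERdef
  -- (14.3)ᵂ: the claim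
  have E143 : ‖Theta2 χ β κs as - ∑ p ∈ primeWindow D, S p‖ ≤ ε / 3 * frakP D := by
    have h := e143 hA β hβ κs as hκ ha
    rwa [sum_finsetOf_univ_wt_eq] at h
  have E010 : ∀ p ∈ primeWindow D,
      ‖S p - wt D β p * (τ * χ (p : ZMod D) / D * ∑ e ∈ Nat.divisorsAntidiagonal D, A e p)‖ ≤
        W * (C₁ * bigP D * bigT D ^ (-c₁)) := by
    intro p hp'
    have h := e010 hA p hp' κs as hκ ha
    rw [hSdef]
    simp only
    rw [← mul_sub, norm_mul]
    have hC : 0 ≤ C₁ * bigP D * bigT D ^ (-c₁) := le_trans (norm_nonneg _) h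
    exact mul_le_mul (hwt p hp') h (norm_nonneg _) hW0
  have E145 : ‖Sx (1, D) - χ (-1) * τ / Nat.totient D * M‖ ≤
      C₂ * bigP D ^ 2 * (D : ℝ) ^ (1 / 2 - c₂) := e145 hA β hβ κs as hκ ha
  have E146 : ∀ e ∈ ER, ‖Sx e‖ ≤ C₃ * bigP D ^ 2 * (D : ℝ) ^ (1 / 2 - c₃) := by
    intro e he
    obtain ⟨hne, he'⟩ := Finset.mem_erase.mp he
    obtain ⟨hmul, hD0'⟩ := Nat.mem_divisorsAntidiagonal.mp he'
    have h1 : 1 < e.1 := by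
      rcases Nat.lt_or_ge 1 e.1 with h | h
      · exact h
      · exfalso
        have he1 : e.1 ≠ 0 := by
          intro h0; rw [h0, zero_mul] at hmul; exact hD0' hmul.symm
        have : e.1 = 1 := by omega
        apply hne
        rw [this, one_mul] at hmul
        exact Prod.ext this hmul
    exact e146 hA β hβ κs as hκ ha e.1 e.2 hmul h1
  -- the algebra: regrouping the main term
  have h1D : ((1, D) : ℕ × ℕ) ∈ Nat.divisorsAntidiagonal D :=
    Nat.mem_divisorsAntidiagonal.mpr ⟨one_mul D, NeZero.ne D⟩
  have hregroup : ∑ p ∈ primeWindow D, wt D β p * (τ * χ (p : ZMod D) / D *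
      ∑ e ∈ Nat.divisorsAntidiagonal D, A e p) = τ / D * Sx (1, D) + τ / D * ∑ e ∈ ER, Sx e := by
    have step1 : ∀ p ∈ primeWindow D, wt D β p * (τ * χ (p : ZMod D) / D *
        ∑ e ∈ Nat.divisorsAntidiagonal D, A e p)
        = ∑ e ∈ Nat.divisorsAntidiagonal D, τ / D * (χ (p : ZMod D) * wt D β p * A e p) := by
      intro p _
      rw [Finset.mul_sum, Finset.mul_sum]
      exact Finset.sum_congr rfl fun e _ => by ring
    rw [Finset.sum_congr rfl step1, Finset.sum_comm]
    have step2 : ∀ e ∈ Nat.divisorsAntidiagonal D,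
        ∑ p ∈ primeWindow D, τ / D * (χ (p : ZMod D) * wt D β p * A e p) = τ / D * Sx e := by
      intro e _
      rw [hSxdef, Finset.mul_sum]
    rw [Finset.sum_congr rfl step2, ← Finset.add_sum_erase _ _ h1D, ← Finset.mul_sum]
  have hmain : τ / D * (χ (-1) * τ / Nat.totient D * M) = main141 χ β κs as := by
    have hsq := chi_neg_one_mul_tau_sq χ hq hp
    have hDc : (D : ℂ) ≠ 0 := Nat.cast_ne_zero.mpr (NeZero.ne D)
    have hM' : main141 χ β κs as = (Nat.totient D : ℂ)⁻¹ * M := by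
      rw [main141_eq, hMdef]
      rfl
    rw [hM']
    calc τ / D * (χ (-1) * τ / Nat.totient D * M)
        = (χ (-1) * τ ^ 2) / D * ((Nat.totient D : ℂ)⁻¹ * M) := by ring
      _ = (Nat.totient D : ℂ)⁻¹ * M := by rw [hsq, div_self hDc, one_mul]
  -- the decomposition of `Θ₂ − main term`
  have hdecomp : Theta2 χ β κs as - main141 χ β κs as =
      (Theta2 χ β κs as - ∑ p ∈ primeWindow D, S p) +
      (∑ p ∈ primeWindow D, (S p - wt D β p * (τ * χ (p : ZMod D) / D *
        ∑ e ∈ Nat.divisorsAntidiagonal D, A e p))) +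
      τ / D * (Sx (1, D) - χ (-1) * τ / Nat.totient D * M) +
      τ / D * ∑ e ∈ ER, Sx e := by
    rw [Finset.sum_sub_distrib, hregroup, ← hmain]
    ring
  -- sizes
  have hτn : ‖τ / (D : ℂ)‖ = Real.sqrt D / D := by
    rw [norm_div, hτdef, norm_tau_eq_sqrt χ hp, Complex.norm_natCast]
  have hsqrt : ∀ c' : ℝ, Real.sqrt D / D * (bigP D ^ 2 * (D : ℝ) ^ (1 / 2 - c')) =
      bigP D ^ 2 * (D : ℝ) ^ (-c') := by
    intro c'
    have h12 : (D : ℝ) ^ (1 / 2 - c') = (D : ℝ) ^ (1 / 2 : ℝ) * (D : ℝ) ^ (-c') := by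
      rw [sub_eq_add_neg, Real.rpow_add hDpos]
    have hh : (D : ℝ) ^ (1 / 2 : ℝ) * (D : ℝ) ^ (1 / 2 : ℝ) = D := by
      rw [← Real.rpow_add hDpos]; norm_num
    rw [Real.sqrt_eq_rpow, h12]
    calc (D : ℝ) ^ (1 / 2 : ℝ) / D * (bigP D ^ 2 * ((D : ℝ) ^ (1 / 2 : ℝ) * (D : ℝ) ^ (-c')))
        = ((D : ℝ) ^ (1 / 2 : ℝ) * (D : ℝ) ^ (1 / 2 : ℝ)) / D * (bigP D ^ 2 * (D : ℝ) ^ (-c')) := by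
          ring
      _ = bigP D ^ 2 * (D : ℝ) ^ (-c') := by rw [hh, div_self hDpos.ne', one_mul]
  have hrpow_le : ∀ c' : ℝ, c ≤ c' → (D : ℝ) ^ (-c') ≤ (D : ℝ) ^ (-c) := fun c' hc' =>
    Real.rpow_le_rpow_of_exponent_le hD1' (by linarith)
  -- term 2: `Σ_p W C₁PT^{-c₁} ≤ W|C₁|T^{-c₁}𝔓`
  have hT0 : 0 ≤ bigT D ^ (-c₁) := Real.rpow_nonneg (Real.exp_pos _).le _
  have term2 : ‖∑ p ∈ primeWindow D,
      (S p - wt D β p * (τ * χ (p : ZMod D) / D * ∑ e ∈ Nat.divisorsAntidiagonal D, A e p))‖ ≤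
        ε / 3 * frakP D := by
    calc ‖∑ p ∈ primeWindow D,
          (S p - wt D β p * (τ * χ (p : ZMod D) / D * ∑ e ∈ Nat.divisorsAntidiagonal D, A e p))‖
        ≤ ∑ p ∈ primeWindow D,
            ‖S p - wt D β p * (τ * χ (p : ZMod D) / D * ∑ e ∈ Nat.divisorsAntidiagonal D, A e p)‖ :=
          norm_sum_le _ _
      _ ≤ ∑ p ∈ primeWindow D, W * |C₁| * bigT D ^ (-c₁) * (p : ℝ) := by
          refine Finset.sum_le_sum fun p hp' => (E010 p hp').trans ?_
          have hPp : bigP D ≤ p := (bigP_lt_of_mem_primeWindow hp').le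
          have hP0 : 0 ≤ bigP D := (Real.exp_pos _).le
          calc W * (C₁ * bigP D * bigT D ^ (-c₁)) ≤ W * (|C₁| * bigP D * bigT D ^ (-c₁)) := by
                gcongr; exact le_abs_self C₁
            _ ≤ W * (|C₁| * p * bigT D ^ (-c₁)) := by gcongr
            _ = W * |C₁| * bigT D ^ (-c₁) * (p : ℝ) := by ring
      _ = W * |C₁| * bigT D ^ (-c₁) * frakP D := by
          rw [← Finset.mul_sum, frakP_eq_sum_primeWindow]
      _ ≤ ε / 3 * frakP D := by gcongr
  -- terms 3 and 4
  have term3 : ‖τ / D * (Sx (1, D) - χ (-1) * τ / Nat.totient D * M)‖ ≤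
      |C₂| * (bigP D ^ 2 * (D : ℝ) ^ (-c)) := by
    rw [norm_mul, hτn]
    calc Real.sqrt D / D * ‖Sx (1, D) - χ (-1) * τ / Nat.totient D * M‖
        ≤ Real.sqrt D / D * (|C₂| * (bigP D ^ 2 * (D : ℝ) ^ (1 / 2 - c₂))) := by
          gcongr
          calc ‖Sx (1, D) - χ (-1) * τ / Nat.totient D * M‖
              ≤ C₂ * bigP D ^ 2 * (D : ℝ) ^ (1 / 2 - c₂) := E145
            _ ≤ |C₂| * bigP D ^ 2 * (D : ℝ) ^ (1 / 2 - c₂) := by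
                gcongr; exact le_abs_self C₂
            _ = |C₂| * (bigP D ^ 2 * (D : ℝ) ^ (1 / 2 - c₂)) := by ring
      _ = |C₂| * (bigP D ^ 2 * (D : ℝ) ^ (-c₂)) := by
          rw [mul_left_comm, hsqrt c₂]
      _ ≤ |C₂| * (bigP D ^ 2 * (D : ℝ) ^ (-c)) :=
          mul_le_mul_of_nonneg_left (mul_le_mul_of_nonneg_left (hrpow_le c₂ (min_le_left _ _))
            (sq_nonneg _)) (abs_nonneg _)
  have hcardER : (ER.card : ℝ) ≤ Cτ * (D : ℝ) ^ (c₃ / 2) := by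
    calc (ER.card : ℝ) ≤ ((Nat.divisorsAntidiagonal D).card : ℝ) := by
          exact_mod_cast Finset.card_erase_le
      _ = (D.divisors.card : ℝ) := by rw [← Nat.map_div_right_divisors, Finset.card_map]
      _ ≤ Cτ * (D : ℝ) ^ (c₃ / 2) := hCτ D (NeZero.ne D)
  have term4 : ‖τ / D * ∑ e ∈ ER, Sx e‖ ≤ |C₃| * Cτ * (bigP D ^ 2 * (D : ℝ) ^ (-c)) := by
    rw [norm_mul, hτn]
    have hP2 : 0 ≤ bigP D ^ 2 := sq_nonneg _
    calc Real.sqrt D / D * ‖∑ e ∈ ER, Sx e‖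
        ≤ Real.sqrt D / D * ∑ e ∈ ER, ‖Sx e‖ := by gcongr; exact norm_sum_le _ _
      _ ≤ Real.sqrt D / D * ∑ e ∈ ER, |C₃| * bigP D ^ 2 * (D : ℝ) ^ (1 / 2 - c₃) := by
          gcongr with e he
          exact (E146 e he).trans (by gcongr; exact le_abs_self C₃)
      _ = ER.card * (|C₃| * (Real.sqrt D / D * (bigP D ^ 2 * (D : ℝ) ^ (1 / 2 - c₃)))) := by
          rw [Finset.sum_const, nsmul_eq_mul]; ring
      _ = ER.card * (|C₃| * (bigP D ^ 2 * (D : ℝ) ^ (-c₃))) := by rw [hsqrt c₃]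
      _ ≤ (Cτ * (D : ℝ) ^ (c₃ / 2)) * (|C₃| * (bigP D ^ 2 * (D : ℝ) ^ (-c₃))) := by
          gcongr
      _ = |C₃| * Cτ * (bigP D ^ 2 * ((D : ℝ) ^ (c₃ / 2) * (D : ℝ) ^ (-c₃))) := by ring
      _ = |C₃| * Cτ * (bigP D ^ 2 * (D : ℝ) ^ (-(c₃ / 2))) := by
          have hx : (D : ℝ) ^ (c₃ / 2) * (D : ℝ) ^ (-c₃) = (D : ℝ) ^ (-(c₃ / 2)) := by
            rw [← Real.rpow_add hDpos]; congr 1; ring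
          rw [hx]
      _ ≤ |C₃| * Cτ * (bigP D ^ 2 * (D : ℝ) ^ (-c)) :=
          mul_le_mul_of_nonneg_left (mul_le_mul_of_nonneg_left
            (hrpow_le (c₃ / 2) (min_le_right _ _)) (sq_nonneg _)) (by positivity)
  have term34 : |C₂| * (bigP D ^ 2 * (D : ℝ) ^ (-c)) + |C₃| * Cτ * (bigP D ^ 2 * (D : ℝ) ^ (-c)) ≤
      ε / 3 * frakP D := by
    have hDc0 : 0 ≤ (D : ℝ) ^ (-c) := Real.rpow_nonneg hDpos.le _
    calc |C₂| * (bigP D ^ 2 * (D : ℝ) ^ (-c)) + |C₃| * Cτ * (bigP D ^ 2 * (D : ℝ) ^ (-c))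
        = K * (bigP D ^ 2 * (D : ℝ) ^ (-c)) := by rw [hK_def]; ring
      _ ≤ K * ((2 * ell D ^ 77 * frakP D) * (D : ℝ) ^ (-c)) := by gcongr
      _ = (K * (2 * Real.log D ^ 77) * (D : ℝ) ^ (-c)) * frakP D := by rw [ell]; ring
      _ ≤ ε / 3 * frakP D := by gcongr
  -- conclusion
  rw [hdecomp]
  have n4 : ∀ a b c d : ℂ, ‖a + b + c + d‖ ≤ ‖a‖ + ‖b‖ + ‖c‖ + ‖d‖ := fun a b c d => by
    calc ‖a + b + c + d‖ ≤ ‖a + b + c‖ + ‖d‖ := norm_add_le _ _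
      _ ≤ ‖a + b‖ + ‖c‖ + ‖d‖ := by gcongr; exact norm_add_le _ _
      _ ≤ ‖a‖ + ‖b‖ + ‖c‖ + ‖d‖ := by gcongr; exact norm_add_le _ _
  refine (n4 _ _ _ _).trans ?_
  linarith [E143, term2, term3, term4, term34]

/-! ### The deduction edge of (14.5) at general `β` -/

section Eq145W

variable {D : ℕ} [NeZero D] (χ : DirichletCharacter ℂ D)

omit [NeZero D] in
/-- **Exchanging the weighted `Σ_{p∼P}` with the `l`-series** (absolutely convergent by
`summable_kappa_mul_DeltaW`), and `θ(−l) = θ(−1)θ(l)` — the twisted twin of `sum_window_tsum_exchange`.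
[cite: Zhang2022LandauSiegel, §14 (14.8) p.79] -/
theorem sum_window_wt_tsum_exchange (hD : 3 ≤ D) {B : ℝ} {κs : ℕ → ℂ} (hκ : Eq141 B κs)
    (β : ℂ) (d k : ℕ) (hk : 1 ≤ k) (θ : DirichletCharacter ℂ (D * k)) :
    ∑ p ∈ primeWindow D, χ (p : ZMod D) * wt D β p * θ⁻¹ (p : ZMod (D * k)) *
        ∑' l : ℕ, κs (d * l) * θ (-(l : ZMod (D * k))) * DeltaW D ((l : ℝ) / ((D : ℝ) * p * k)) =
      θ (-1) * ∑' l : ℕ, κs (d * l) * θ (l : ZMod (D * k)) *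
        ∑ p ∈ primeWindow D, χ (p : ZMod D) * θ⁻¹ (p : ZMod (D * k)) * wt D β p *
          DeltaW D ((l : ℝ) / ((D : ℝ) * p * k)) := by
  have hsum : ∀ p ∈ primeWindow D, Summable fun l : ℕ =>
      χ (p : ZMod D) * wt D β p * θ⁻¹ (p : ZMod (D * k)) *
        (κs (d * l) * θ (-(l : ZMod (D * k))) * DeltaW D ((l : ℝ) / ((D : ℝ) * p * k))) := by
    intro p hp
    have hp0 : (0 : ℝ) < p := by exact_mod_cast (Finset.mem_filter.mp hp).2.pos
    have hD0 : (0 : ℝ) < D := by exact_mod_cast (show 0 < D by omega)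
    have hk0 : (0 : ℝ) < k := by exact_mod_cast hk
    have hQ : (0 : ℝ) < (D : ℝ) * p * k := by positivity
    exact (summable_kappa_mul_DeltaW hD hκ d hQ (g := fun l => θ (-(l : ZMod (D * k))))
      (G := 1) (fun l => DirichletCharacter.norm_le_one θ _)).mul_left _
  calc ∑ p ∈ primeWindow D, χ (p : ZMod D) * wt D β p * θ⁻¹ (p : ZMod (D * k)) *
        ∑' l : ℕ, κs (d * l) * θ (-(l : ZMod (D * k))) * DeltaW D ((l : ℝ) / ((D : ℝ) * p * k))
      = ∑ p ∈ primeWindow D, ∑' l : ℕ, χ (p : ZMod D) * wt D β p * θ⁻¹ (p : ZMod (D * k)) *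
          (κs (d * l) * θ (-(l : ZMod (D * k))) * DeltaW D ((l : ℝ) / ((D : ℝ) * p * k))) := by
        refine Finset.sum_congr rfl fun p _ => ?_
        rw [tsum_mul_left]
    _ = ∑' l : ℕ, ∑ p ∈ primeWindow D, χ (p : ZMod D) * wt D β p * θ⁻¹ (p : ZMod (D * k)) *
          (κs (d * l) * θ (-(l : ZMod (D * k))) * DeltaW D ((l : ℝ) / ((D : ℝ) * p * k))) :=
        (Summable.tsum_finsetSum hsum).symm
    _ = ∑' l : ℕ, θ (-1) * (κs (d * l) * θ (l : ZMod (D * k)) *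
          ∑ p ∈ primeWindow D, χ (p : ZMod D) * θ⁻¹ (p : ZMod (D * k)) * wt D β p *
            DeltaW D ((l : ℝ) / ((D : ℝ) * p * k))) := by
        refine tsum_congr fun l => ?_
        have hneg : θ (-(l : ZMod (D * k))) = θ (-1) * θ (l : ZMod (D * k)) := by
          rw [← map_mul, neg_one_mul]
        rw [Finset.mul_sum, Finset.mul_sum]
        refine Finset.sum_congr rfl fun p _ => ?_
        rw [hneg]; ring
    _ = _ := tsum_mul_left

omit [NeZero D] in
/-- **The rest term of (14.7), summed over the window against `χ(p)(pt₀)^β`, is bounded by the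
twisted left side of (14.8)** — the twin of `norm_sum_window_rest_le`.
[cite: Zhang2022LandauSiegel, §14 (14.8) p.79] -/
theorem norm_sum_window_wt_rest_le (hD : 3 ≤ D) {B : ℝ} {κs : ℕ → ℂ} (hκ : Eq141 B κs)
    (β : ℂ) (as : ℕ → ℂ) :
    ‖∑ p ∈ primeWindow D, χ (p : ZMod D) * wt D β p *
        ∑ d ∈ Finset.Icc 1 ⌊2 * P4 D⌋₊, (d : ℂ)⁻¹ * ∑ k ∈ Finset.Icc 1 ⌊2 * P4 D⌋₊,
          as (d * k) / ((k : ℂ) * Nat.totient (D * k)) *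
            ∑ θ ∈ finsetOf {θ : DirichletCharacter ℂ (D * k) | θ ≠ 1 ∧ θ ≠ thetaOne χ k},
              tauSum (D * k) θ⁻¹ * θ⁻¹ (p : ZMod (D * k)) *
                ∑' l : ℕ, κs (d * l) * θ (-(l : ZMod (D * k))) *
                  DeltaW D ((l : ℝ) / ((D : ℝ) * p * k))‖ ≤ lhs148W χ β κs as := by
  -- move the `p`-sum inside
  have hre : ∑ p ∈ primeWindow D, χ (p : ZMod D) * wt D β p *
        ∑ d ∈ Finset.Icc 1 ⌊2 * P4 D⌋₊, (d : ℂ)⁻¹ * ∑ k ∈ Finset.Icc 1 ⌊2 * P4 D⌋₊,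
          as (d * k) / ((k : ℂ) * Nat.totient (D * k)) *
            ∑ θ ∈ finsetOf {θ : DirichletCharacter ℂ (D * k) | θ ≠ 1 ∧ θ ≠ thetaOne χ k},
              tauSum (D * k) θ⁻¹ * θ⁻¹ (p : ZMod (D * k)) *
                ∑' l : ℕ, κs (d * l) * θ (-(l : ZMod (D * k))) *
                  DeltaW D ((l : ℝ) / ((D : ℝ) * p * k)) =
      ∑ d ∈ Finset.Icc 1 ⌊2 * P4 D⌋₊, (d : ℂ)⁻¹ * ∑ k ∈ Finset.Icc 1 ⌊2 * P4 D⌋₊,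
          as (d * k) / ((k : ℂ) * Nat.totient (D * k)) *
            ∑ θ ∈ finsetOf {θ : DirichletCharacter ℂ (D * k) | θ ≠ 1 ∧ θ ≠ thetaOne χ k},
              tauSum (D * k) θ⁻¹ * (θ (-1) * ∑' l : ℕ, κs (d * l) * θ (l : ZMod (D * k)) *
                ∑ p ∈ primeWindow D, χ (p : ZMod D) * θ⁻¹ (p : ZMod (D * k)) * wt D β p *
                  DeltaW D ((l : ℝ) / ((D : ℝ) * p * k))) := by
    -- both sides equal the quadruple sum with `p` innermost
    have lhs : ∑ p ∈ primeWindow D, χ (p : ZMod D) * wt D β p *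
        ∑ d ∈ Finset.Icc 1 ⌊2 * P4 D⌋₊, (d : ℂ)⁻¹ * ∑ k ∈ Finset.Icc 1 ⌊2 * P4 D⌋₊,
          as (d * k) / ((k : ℂ) * Nat.totient (D * k)) *
            ∑ θ ∈ finsetOf {θ : DirichletCharacter ℂ (D * k) | θ ≠ 1 ∧ θ ≠ thetaOne χ k},
              tauSum (D * k) θ⁻¹ * θ⁻¹ (p : ZMod (D * k)) *
                ∑' l : ℕ, κs (d * l) * θ (-(l : ZMod (D * k))) *
                  DeltaW D ((l : ℝ) / ((D : ℝ) * p * k)) =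
        ∑ d ∈ Finset.Icc 1 ⌊2 * P4 D⌋₊, ∑ k ∈ Finset.Icc 1 ⌊2 * P4 D⌋₊,
          ∑ θ ∈ finsetOf {θ : DirichletCharacter ℂ (D * k) | θ ≠ 1 ∧ θ ≠ thetaOne χ k},
            (d : ℂ)⁻¹ * (as (d * k) / ((k : ℂ) * Nat.totient (D * k))) * tauSum (D * k) θ⁻¹ *
              ∑ p ∈ primeWindow D, χ (p : ZMod D) * wt D β p * θ⁻¹ (p : ZMod (D * k)) *
                ∑' l : ℕ, κs (d * l) * θ (-(l : ZMod (D * k))) *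
                  DeltaW D ((l : ℝ) / ((D : ℝ) * p * k)) := by
      simp only [Finset.mul_sum]
      rw [Finset.sum_comm]
      refine Finset.sum_congr rfl fun d _ => ?_
      rw [Finset.sum_comm]
      refine Finset.sum_congr rfl fun k _ => ?_
      rw [Finset.sum_comm]
      refine Finset.sum_congr rfl fun θ _ => Finset.sum_congr rfl fun p _ => ?_
      ring
    rw [lhs]
    have step : ∀ d ∈ Finset.Icc 1 ⌊2 * P4 D⌋₊, ∀ k ∈ Finset.Icc 1 ⌊2 * P4 D⌋₊,
        ∀ θ ∈ finsetOf {θ : DirichletCharacter ℂ (D * k) | θ ≠ 1 ∧ θ ≠ thetaOne χ k},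
        (d : ℂ)⁻¹ * (as (d * k) / ((k : ℂ) * Nat.totient (D * k))) * tauSum (D * k) θ⁻¹ *
            ∑ p ∈ primeWindow D, χ (p : ZMod D) * wt D β p * θ⁻¹ (p : ZMod (D * k)) *
              ∑' l : ℕ, κs (d * l) * θ (-(l : ZMod (D * k))) *
                DeltaW D ((l : ℝ) / ((D : ℝ) * p * k)) =
          (d : ℂ)⁻¹ * (as (d * k) / ((k : ℂ) * Nat.totient (D * k)) *
            (tauSum (D * k) θ⁻¹ * (θ (-1) * ∑' l : ℕ, κs (d * l) * θ (l : ZMod (D * k)) *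
              ∑ p ∈ primeWindow D, χ (p : ZMod D) * θ⁻¹ (p : ZMod (D * k)) * wt D β p *
                DeltaW D ((l : ℝ) / ((D : ℝ) * p * k))))) := by
      intro d _ k hk θ _
      have hk1 : 1 ≤ k := (Finset.mem_Icc.mp hk).1
      rw [sum_window_wt_tsum_exchange χ hD hκ β d k hk1 θ]
      ring
    rw [Finset.sum_congr rfl fun d hd => Finset.sum_congr rfl fun k hk =>
      Finset.sum_congr rfl fun θ hθ => step d hd k hk θ hθ]
    simp only [← Finset.mul_sum]
  rw [hre, lhs148W]
  -- termwise norm bounds through the three finite sums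
  refine (norm_sum_le _ _).trans (Finset.sum_le_sum fun d _ => ?_)
  rw [norm_mul, norm_inv, Complex.norm_natCast]
  refine mul_le_mul_of_nonneg_left ?_ (by positivity)
  refine (norm_sum_le _ _).trans (Finset.sum_le_sum fun k _ => ?_)
  rw [norm_mul, norm_div, norm_mul, Complex.norm_natCast, Complex.norm_natCast, mul_comm (k : ℝ)]
  refine mul_le_mul_of_nonneg_left ?_ (by positivity)
  refine (norm_sum_le _ _).trans (Finset.sum_le_sum fun θ _ => ?_)
  rw [norm_mul, norm_mul]
  refine mul_le_mul_of_nonneg_left ?_ (norm_nonneg _)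
  calc ‖θ (-1)‖ * ‖∑' l : ℕ, κs (d * l) * θ (l : ZMod (D * k)) *
          ∑ p ∈ primeWindow D, χ (p : ZMod D) * θ⁻¹ (p : ZMod (D * k)) * wt D β p *
            DeltaW D ((l : ℝ) / ((D : ℝ) * p * k))‖
      ≤ 1 * ‖∑' l : ℕ, κs (d * l) * θ (l : ZMod (D * k)) *
          ∑ p ∈ primeWindow D, χ (p : ZMod D) * θ⁻¹ (p : ZMod (D * k)) * wt D β p *
            DeltaW D ((l : ℝ) / ((D : ℝ) * p * k))‖ := by
        gcongr; exact DirichletCharacter.norm_le_one θ _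
    _ = _ := one_mul _

end Eq145W

/-- **(14.5) at general `β` from (14.7), u013, u015 and the twisted (14.8)** — the general-`β` twin
of `dedEq145_holds` (§14 pp. 78–79, tex L3918–L3950; "the general case is almost identical", p. 76):
per `p`, (14.7) (`Eq147`) and u015 (`Step14u015`) split `𝒮(1,D;p)` along `θ = ψ⁰`, `θ = θ_k¹`, rest
(`calS_one_split`); against the weight `χ(p)(pt₀)^β` the principal terms are `≤ e^{15π}·C·P𝓛ᶜ` each
(u013a/b, `norm_wt_le`), `≤ 3P` primes; the `θ_k¹` terms give `χ(−1)τ(χ)/φ(D)·Σ_p (pt₀)^β mainSum14(p)`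
(`χ(p)χ(−p) = χ(−1)`); the rest is bounded by `lhs148W` (`norm_sum_window_wt_rest_le`), hence by the
twisted (14.8); finally `P²𝓛ᶜ + P²D^{−c₈} ≤ C·P²D^{1/2−c}`, `c = min(c₈,1/4)`.
[cite: Zhang2022LandauSiegel, §14 (14.5) (proof) pp.78–79, tex L3918–L3950] -/
theorem eq145W_of_parts (h147 : Eq147) (h13a : Step14u013a) (h13b : Step14u013b)
    (h15 : Step14u015)
    (h148 : ∀ B : ℝ, ∃ c : ℝ, 0 < c ∧ ∃ C : ℝ, ForAllLarge fun D _ χ => AssumptionA D χ →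
      ∀ β : ℂ, ‖β‖ < 5 * alpha D → ∀ κs as : ℕ → ℂ, Eq141 B κs → Eq142 D B as →
        lhs148W χ β κs as ≤ C * bigP D ^ 2 * (D : ℝ) ^ (-c)) :
    ∀ B : ℝ, ∃ c : ℝ, 0 < c ∧ ∃ C : ℝ, ForAllLarge fun D _ χ => AssumptionA D χ →
      ∀ β : ℂ, ‖β‖ < 5 * alpha D → ∀ κs as : ℕ → ℂ, Eq141 B κs → Eq142 D B as →
        ‖(∑ p ∈ primeWindow D, χ (p : ZMod D) * wt D β p * calS D 1 D p κs as) -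
            χ (-1) * GammaFactor.tau χ / Nat.totient D *
              ∑ p ∈ primeWindow D, wt D β p * mainSum14 χ p κs as‖
          ≤ C * bigP D ^ 2 * (D : ℝ) ^ (1 / 2 - c) := by
  intro B
  obtain ⟨Ca, ha⟩ := h13a B
  obtain ⟨cb, Cb, hb⟩ := h13b B
  obtain ⟨c₈, hc₈, C₈, h8⟩ := h148 B
  set W : ℝ := Real.exp (15 * π) with hW_def
  have hW0 : 0 ≤ W := (Real.exp_pos _).le
  set c : ℝ := min c₈ (1 / 4) with hc_def
  refine ⟨c, lt_min hc₈ (by norm_num), 3 * W * |Ca| * |Cb| + |C₈|, ?_⟩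
  obtain ⟨D₀, hall⟩ := ((((h147 B).and ha).and hb).and (h15 B)).and h8
  obtain ⟨D₁, hD₁⟩ := eventually_log_rpow_le_rpow_quarter cb
  obtain ⟨D₃, hD₃⟩ := exists_nat_forall_le_ell 3
  refine ⟨max (max (max D₀ D₁) 3) D₃, fun D _ χ hD hq hp hA β hβ κs as hκ has => ?_⟩
  have hD0 : D₀ ≤ D := le_trans (le_trans (le_trans (le_max_left _ _) (le_max_left _ _)) (le_max_left _ _)) hD
  have hD1 : D₁ ≤ D := le_trans (le_trans (le_trans (le_max_right _ _) (le_max_left _ _)) (le_max_left _ _)) hD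
  have hD3 : 3 ≤ D := le_trans (le_trans (le_max_right _ _) (le_max_left _ _)) hD
  have hℓ3 : 3 ≤ ell D := hD₃ D (le_trans (le_max_right _ _) hD)
  obtain ⟨⟨⟨⟨e147, ea⟩, eb⟩, e15⟩, e8⟩ := hall D χ hD0 hq hp
  have hDne1 : D ≠ 1 := by omega
  have hDpos : (0 : ℝ) < D := by exact_mod_cast (show 0 < D by omega)
  have hD1' : (1 : ℝ) ≤ D := by exact_mod_cast (show 1 ≤ D by omega)
  have hP0 : 0 ≤ bigP D := (Real.exp_pos _).le
  have hwt : ∀ p ∈ primeWindow D, ‖wt D β p‖ ≤ W := fun p hp' => norm_wt_le hℓ3 hp' hβ.le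
  -- per-`p` decomposition and the main term
  have hsplit : ∀ p ∈ primeWindow D, χ (p : ZMod D) * wt D β p * calS D 1 D p κs as =
      wt D β p * (χ (p : ZMod D) * princ147 D p κs as) +
      χ (-1) * GammaFactor.tau χ / Nat.totient D * (wt D β p * mainSum14 χ p κs as) +
      χ (p : ZMod D) * wt D β p *
        ∑ d ∈ Finset.Icc 1 ⌊2 * P4 D⌋₊, (d : ℂ)⁻¹ * ∑ k ∈ Finset.Icc 1 ⌊2 * P4 D⌋₊,
        as (d * k) / ((k : ℂ) * Nat.totient (D * k)) *
          ∑ θ ∈ finsetOf {θ : DirichletCharacter ℂ (D * k) | θ ≠ 1 ∧ θ ≠ thetaOne χ k},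
            tauSum (D * k) θ⁻¹ * θ⁻¹ (p : ZMod (D * k)) *
              ∑' l : ℕ, κs (d * l) * θ (-(l : ZMod (D * k))) *
                DeltaW D ((l : ℝ) / ((D : ℝ) * p * k)) := by
    intro p hpW
    rw [calS_one_split χ hq hp hDne1 p κs as (e147 p hpW κs as hκ has) (e15 p hpW κs as hκ has)]
    have hχ2 := chi_sq_of_mem_primeWindow χ hq hD3 hpW
    have hneg : χ (-(p : ZMod D)) = χ (-1) * χ (p : ZMod D) := by rw [← map_mul, neg_one_mul]
    rw [hneg]
    have key : ∀ w x a y t f m r : ℂ, x * x = 1 →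
        x * w * (a + y * x * t / f * m + r) = w * (x * a) + y * t / f * (w * m) + x * w * r := by
      intro w x a y t f m r hx
      linear_combination (w * y * t / f * m) * hx
    exact key _ _ _ _ _ _ _ _ hχ2
  have hsum : ∑ p ∈ primeWindow D, χ (p : ZMod D) * wt D β p * calS D 1 D p κs as -
      χ (-1) * GammaFactor.tau χ / Nat.totient D *
        ∑ p ∈ primeWindow D, wt D β p * mainSum14 χ p κs as =
      ∑ p ∈ primeWindow D, wt D β p * (χ (p : ZMod D) * princ147 D p κs as) +
      ∑ p ∈ primeWindow D, χ (p : ZMod D) * wt D β p *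
        ∑ d ∈ Finset.Icc 1 ⌊2 * P4 D⌋₊, (d : ℂ)⁻¹ * ∑ k ∈ Finset.Icc 1 ⌊2 * P4 D⌋₊,
          as (d * k) / ((k : ℂ) * Nat.totient (D * k)) *
            ∑ θ ∈ finsetOf {θ : DirichletCharacter ℂ (D * k) | θ ≠ 1 ∧ θ ≠ thetaOne χ k},
              tauSum (D * k) θ⁻¹ * θ⁻¹ (p : ZMod (D * k)) *
                ∑' l : ℕ, κs (d * l) * θ (-(l : ZMod (D * k))) *
                  DeltaW D ((l : ℝ) / ((D : ℝ) * p * k)) := by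
    rw [Finset.sum_congr rfl hsplit, Finset.sum_add_distrib, Finset.sum_add_distrib, Finset.mul_sum]
    ring
  rw [hsum]
  -- the principal-character terms
  have hprinc : ‖∑ p ∈ primeWindow D, wt D β p * (χ (p : ZMod D) * princ147 D p κs as)‖ ≤
      3 * W * |Ca| * |Cb| * bigP D ^ 2 * Real.log D ^ cb := by
    calc ‖∑ p ∈ primeWindow D, wt D β p * (χ (p : ZMod D) * princ147 D p κs as)‖
        ≤ ∑ p ∈ primeWindow D, ‖wt D β p * (χ (p : ZMod D) * princ147 D p κs as)‖ := norm_sum_le _ _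
      _ ≤ ∑ p ∈ primeWindow D, W * (|Ca| * |Cb| * bigP D * Real.log D ^ cb) := by
          refine Finset.sum_le_sum fun p hpW => ?_
          rw [norm_mul, norm_mul]
          have h1 := ea p hpW κs as hκ has
          have h2 := eb hA p hpW κs as hκ has
          have hm0 := major1413_nonneg (D := D) p κs as
          have hℓ : 0 ≤ ell D ^ cb := Real.rpow_nonneg (Real.log_natCast_nonneg D) _
          have hinner : ‖χ (p : ZMod D)‖ * ‖princ147 D p κs as‖ ≤
              |Ca| * |Cb| * bigP D * Real.log D ^ cb := by
            calc ‖χ (p : ZMod D)‖ * ‖princ147 D p κs as‖ ≤ 1 * (Ca * major1413 D p κs as) := by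
                  gcongr; exact DirichletCharacter.norm_le_one χ _
              _ ≤ |Ca| * major1413 D p κs as := by
                  rw [one_mul]; gcongr; exact le_abs_self Ca
              _ ≤ |Ca| * (Cb * bigP D * ell D ^ cb) := by gcongr
              _ ≤ |Ca| * (|Cb| * bigP D * ell D ^ cb) := by gcongr; exact le_abs_self Cb
              _ = |Ca| * |Cb| * bigP D * Real.log D ^ cb := by rw [ell]; ring
          have hin0 : 0 ≤ ‖χ (p : ZMod D)‖ * ‖princ147 D p κs as‖ := by positivity
          exact mul_le_mul (hwt p hpW) hinner hin0 hW0
      _ = (primeWindow D).card * (W * (|Ca| * |Cb| * bigP D * Real.log D ^ cb)) := by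
          rw [Finset.sum_const, nsmul_eq_mul]
      _ ≤ (3 * bigP D) * (W * (|Ca| * |Cb| * bigP D * Real.log D ^ cb)) := by
          have hℓ : 0 ≤ Real.log D ^ cb := Real.rpow_nonneg (Real.log_natCast_nonneg D) _
          gcongr; exact card_primeWindow_le hD3
      _ = 3 * W * |Ca| * |Cb| * bigP D ^ 2 * Real.log D ^ cb := by ring
  have hrest := norm_sum_window_wt_rest_le χ hD3 hκ β as
  have h148 : lhs148W χ β κs as ≤ |C₈| * bigP D ^ 2 * (D : ℝ) ^ (-c₈) := by
    refine (e8 hA β hβ κs as hκ has).trans ?_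
    gcongr; exact le_abs_self C₈
  -- exponents
  have hc4 : 1 / 4 ≤ 1 / 2 - c := by have := min_le_right c₈ (1 / 4); linarith
  have hlog : Real.log D ^ cb ≤ (D : ℝ) ^ (1 / 2 - c) :=
    (hD₁ D hD1).trans (Real.rpow_le_rpow_of_exponent_le hD1' hc4)
  have hDc : (D : ℝ) ^ (-c₈) ≤ (D : ℝ) ^ (1 / 2 - c) :=
    Real.rpow_le_rpow_of_exponent_le hD1' (by have := min_le_left c₈ (1 / 4); linarith)
  refine (norm_add_le _ _).trans ?_
  refine (add_le_add hprinc (hrest.trans h148)).trans ?_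
  have hP2 : 0 ≤ bigP D ^ 2 := sq_nonneg _
  calc 3 * W * |Ca| * |Cb| * bigP D ^ 2 * Real.log D ^ cb + |C₈| * bigP D ^ 2 * (D : ℝ) ^ (-c₈)
      ≤ 3 * W * |Ca| * |Cb| * bigP D ^ 2 * (D : ℝ) ^ (1 / 2 - c) +
        |C₈| * bigP D ^ 2 * (D : ℝ) ^ (1 / 2 - c) := by gcongr
    _ = (3 * W * |Ca| * |Cb| + |C₈|) * bigP D ^ 2 * (D : ℝ) ^ (1 / 2 - c) := by ring

end Literature.NumberTheory.LFunctions.Zhang2022.Typed.Sec14
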